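import Summits.Ventures.PercRepro.GenQLargeGen

/-!
# PercRepro — the size chain of the core at every rank, and THEOREM LARGE on the core for every `q` (night-4, gen 7)

On a Core matroid with `f(4) ≤ 10` every rank-`r` flat has `≤ fCore r` points, `fCore = 3, 3, 3, 6, 10, 21` at
`r ≤ 5` and `fCore (r + 1) = 2·fCore r + 1` beyond (`43, 87, 175, …`): the `(8, 6)` cell's doubling step
(`card_le_fortythree_of_core_of_ten`: `F ∖ e` is covered by two flats of lower rank, night-3's
`exists_cover_erase_of_core`) run as an induction on the rank (`card_le_fCore_of_core`).  Hence the size chain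
`SizeChain M q fCore` at EVERY `q` (`sizeChain_core`) and, with `GenQLargeGen`, THEOREM LARGE on the core for every
`q`: **`jq_nonneg_of_large_core`** — `0 ≤ lbSumQ q fCore t |G|` gives `0 ≤ Jq M G q t` on every rank-`q` set of the
core.  What remains per `q` is the rational computation `0 ≤ lbSumQ q fCore t n` alone (`GenQLargeSevenNum*` at `q = 7`).
Imports `GenQLargeGen`.
-/
namespace PercRepro.Night4

open Finset ThmH SixFour GenQ PerFlat Star NightThree

variable {α : Type} [DecidableEq α] {M : Matroid α} [M.Finite]

/-- The size chain of the core: `3, 3, 3, 6, 10, 21`, then `fCore (r + 1) = 2·fCore r + 1`. -/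
def fCore : ℕ → ℕ
  | 0 => 3
  | 1 => 3
  | 2 => 3
  | 3 => 6
  | 4 => 10
  | 5 => 21
  | r + 6 => 2 * fCore (r + 5) + 1

/-- `fCore` is monotone. -/
theorem fCore_mono : Monotone fCore := by
  apply monotone_nat_of_le_succ
  intro r
  match r with
  | 0 => simp [fCore]
  | 1 => simp [fCore]
  | 2 => simp [fCore]
  | 3 => simp [fCore]
  | 4 => simp [fCore]
  | 5 => simp [fCore]
  | r + 6 =>
    show fCore (r + 6) ≤ 2 * fCore (r + 6) + 1
    omega

/-- `fCore 6 = 43`. -/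
theorem fCore_six : fCore 6 = 43 := rfl

/-- `fCore 7 = 87`. -/
theorem fCore_seven : fCore 7 = 87 := rfl

/-- `fCore 8 = 175`. -/
theorem fCore_eight : fCore 8 = 175 := rfl

/-- **Every rank-`r` flat of the core has `≤ fCore r` points** (`Core M p`, `f(4) ≤ 10`). -/
theorem card_le_fCore_of_core {p : ℕ} (hc : Core M p) (h10 : ∀ F ∈ flatsQ M 4, F.card ≤ 10) :
    ∀ (r : ℕ) (F : Finset α), F ∈ flatsQ M r → F.card ≤ fCore r := by
  have hh : CoreHyps M := coreHyps_of_core hc h10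
  intro r
  induction r using Nat.strong_induction_on with
  | _ r ih =>
    intro F hF
    have hF' := mem_flatsQ.1 hF
    by_cases hr5 : r ≤ 5
    · interval_cases r
      · exact card_le_three_of_eRk_le_two' hh.1 hh.2.1 hF'.1 (hF'.2.2.le.trans (by norm_num))
      · exact card_le_three_of_eRk_le_two' hh.1 hh.2.1 hF'.1 (hF'.2.2.le.trans (by norm_num))
      · exact card_le_three_of_eRk_le_two' hh.1 hh.2.1 hF'.1 hF'.2.2.le
      · exact hh.2.2.1 F hF
      · exact h10 F hF
      · exact hh.2.2.2.2 F hF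
    · rw [not_le] at hr5
      rcases F.eq_empty_or_nonempty with hemp | ⟨e, he⟩
      · rw [hemp, Finset.card_empty]
        exact Nat.zero_le _
      obtain ⟨F₁, F₂, r₁, r₂, hr₁, hr₂, hF₁, hF₂, _, _, hcov⟩ := exists_cover_erase_of_core hc hF he
      have h1 := (ih r₁ hr₁ F₁ hF₁).trans (fCore_mono (Nat.le_sub_one_of_lt hr₁))
      have h2 := (ih r₂ hr₂ F₂ hF₂).trans (fCore_mono (Nat.le_sub_one_of_lt hr₂))
      have hcard : F.card = (F.erase e).card + 1 := by rw [Finset.card_erase_add_one he]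
      have hle : (F.erase e).card ≤ F₁.card + F₂.card :=
        (Finset.card_le_card hcov).trans (Finset.card_union_le _ _)
      have hrec : fCore r = 2 * fCore (r - 1) + 1 := by
        obtain ⟨s, hs⟩ : ∃ s, r = s + 6 := ⟨r - 6, by omega⟩
        subst hs
        show fCore (s + 6) = 2 * fCore (s + 6 - 1) + 1
        rfl
      omega

/-- **The size chain of the core at every rank**: `SizeChain M q fCore` for every `q`. -/
theorem sizeChain_core {p : ℕ} (hc : Core M p) (h10 : ∀ F ∈ flatsQ M 4, F.card ≤ 10) (q : ℕ) :
    SizeChain M q fCore :=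
  sizeChain_of_flats fCore_mono (fun r _ F hF => card_le_fCore_of_core hc h10 r F hF)

/-- **THEOREM LARGE ON THE CORE AT EVERY RANK**: on a rank-`q` set `G` of a Core matroid with `f(4) ≤ 10`,
`0 ≤ lbSumQ q fCore t |G|` gives `0 ≤ Jq M G q t` (`2 ≤ q`, `t ≤ q + 2`) — the numerics are all that is left per `q`. -/
theorem jq_nonneg_of_large_core {p : ℕ} (hc : Core M p) (h10 : ∀ F ∈ flatsQ M 4, F.card ≤ 10) {q : ℕ}
    (hq : 2 ≤ q) {G : Finset α} (hG : G ⊆ gr M) (hrG : M.eRk (G : Set α) = (q : ℕ∞)) {t : ℕ}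
    (ht : t ≤ q + 2) (hnum : 0 ≤ lbSumQ q fCore t G.card) : 0 ≤ Jq M G q t :=
  jq_nonneg_of_lbSumQ (simple_of_core hc) (sizeChain_core hc h10 q) hq hG hrG ht hnum

end PercRepro.Night4
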